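import Mathlib
import Literature.MathematicalPhysics.QuantumFieldTheory.Balaban1983to89.B10Eq26MeasureInv
import Literature.MathematicalPhysics.QuantumFieldTheory.Balaban1983to89.B12Inv329

/-!
# `Balaban1983to89.B13Inv214Orbit` — [II] pp. 21–22, the LAST REMARK on the expressions (2.14): gauge invariance
# under the `G`-valued transformations, its extension *«by the analyticity»* to the `Gᶜ`-valued ones near `G`, and the
# extension to *«constant functions on whole orbits»* — TYPED SKELETON, kernel-checked modulo ONE named hypothesis shape

Paper sub-cell B13 of the Bałaban programme audit (cell `pub-balaban`), generation 20 (v1).  Companion records: cell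
GAPS G-B13-06 / G-B13-06a (reading rule for `Gᶜ`-valued `u`), G-adv7-7 (block-constancy caveat of [I] (3.29)),
C-B13-32 / C-B13-43 (the same identity principle in the CONFIGURATION variable, b10 lineage), C-B13-44 (this module);
`b2b-balaban-b13/CENSUS-B13-v2.md` row «p. 21–22».  VALUE = the logical structure of one printed paragraph fixed by
the kernel: which of its four clauses are inputs (located hypothesis SHAPES, nothing asserted), which is a [folklore]
theorem of one complex variable carried as the hypothesis shape (H6) `TubeIdentity` of the sibling module
`…B10Eq26MeasureInv` (to be discharged THERE — b10 lineage, CLAIMS.log l.52595 — not here), and which are kernel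
glue.  NOT summit progress; NO disputed step of the papers under audit is certified; in particular NOTHING is said
about whether Bałaban's spaces of configurations (conditions I.(i)–(iv)) are mapped into the analyticity domains by the
near-`G` transformations (the «slot» question of G-B13-06a / G-adv7-7 stays exactly as filed).

CITATION HEADER (lean-in-tree rule 2026-08-18).  Source (held; quotation READ AS IMAGE from the renders
`b2b-balaban-ref1/pages/1988-cmp116-rg-II-cluster/1988-cmp116-rg-II-cluster-p021-x2.png`, `…-p022-x2.png`):
* [Balaban1988RG2Cluster] = B13 = [II], T. Bałaban, *Renormalization group approach to lattice gauge field theories.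
  II. Cluster expansions*, Commun. Math. Phys. **116** (1988) 1–22 (`paper:balaban1988-cmp116-rg-ii-cluster`),
  p. 21 last paragraph → p. 22 first paragraph, VERBATIM: *«Let us make a last remark about the expressions (2.14). By
  Lemma 2, and the transformation properties of the operators in (2.14) with respect to gauge transformations, e.g.
  see (3.28)–(3.34) [13], the expressions (2.14) are gauge invariant with respect to all G-valued transformations. The
  expressions are analytic functions of (U, J), hence the invariance can be extended, by the analyticity, to Gᶜ-valued
  gauge transformations in a small neighborhood of the space of G-valued ones. This means that the expressions are
  constant on intersections of orbits with the corresponding space of configurations (U, J) satisfying the conditions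
  I.(i)–(iv). We extend them to constant functions on whole orbits having non-empty intersections with the space.»*
  and p. 22: *«The above remark completes the proof of the inductive assumptions for the action A_{k+1}, hence the
  proof of Theorem I.3.»*
* [Balaban1987RG1] = B12 = [I], Commun. Math. Phys. **109** (1987) 249–301, p. 276 (3.29) (*«for Gᶜ-valued
  transformations u in a sufficiently small neighborhood of G-valued transformations, so that the configurations after
  the transformations belong to proper spaces also»*) and p. 283 (*«extended analytically»*) — quoted in full in
  `…B13GaugeDevices` §0 and `…B10Eq26MeasureInv` §0; not re-read here.
* [Balaban1985BackgroundPropagators] = B9 = [13], Commun. Math. Phys. **99** (1985), p. 395 (3.28) *«Uᵘ(x, x′) =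
  u(x)U(x, x′)u⁻¹(x′)»* — the FORMULA of the action typed below (with `u⁻¹`, not `u*`: for `Gᶜ`-valued `u` the two
  differ, and only the former is holomorphic in `u`); quoted in full in `…B13GaugeDevices` §0.

THE FOUR CLAUSES AND THEIR STATUS HERE.
* (R1) *«the expressions (2.14) are gauge invariant with respect to all G-valued transformations»* — INPUT, the
  hypothesis `hG` below (invariance under UNITARY-valued `u`); its printed support (Lemma 2 + [13] (3.28)–(3.34)) is
  the business of `…B13GaugeDevices` (device algebra, kernel) and of G-adv7-7 / G-B13-06a (for which `u` it is
  actually delivered: block-constant ones); nothing of it is asserted here.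
* (R2) *«The expressions are analytic functions of (U, J), hence the invariance can be extended, by the analyticity,
  to Gᶜ-valued gauge transformations in a small neighborhood of the space of G-valued ones»* — KERNEL modulo (H6):
  `gcInvariant_of_gInvariant` / `gcInvariant_of_analyticOn`.  The *«small neighborhood»* is the bondwise (here:
  sitewise) TUBE `TubeCfg S 𝔸 a = {u | ∀ x, u x = exp(B_x)·g_x, ‖B_x‖ < a, g_x unitary}` of `…B10Eq29TubeLine`
  (a neighbourhood of every unitary-valued `u`, `B10Eq61Leaves`); the one-variable identity principle along the
  unitary slice is EXACTLY the hypothesis shape (H6) `B10Eq26MeasureInv.TubeIdentity S 𝔸 a` read in the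
  gauge-transformation variable (index type := sites) — carried as the binder `hId`, discharged by the b10 lineage's
  `tubeIdentity` (pending at the time of writing) by `exact`.  The passage from *«analytic functions of (U, J)»* to
  analyticity IN `u` is kernel (`differentiableAt_gaugeAct`, chain rule) GIVEN that the near-orbit
  `{Vᵘ : u ∈ tube}` lies in the analyticity domain — the explicit binder `hmaps`, which is [I] p. 276's proviso
  *«so that the configurations after the transformations belong to proper spaces also»* and is NOT discharged.
* (R3) *«This means that the expressions are constant on intersections of orbits with the corresponding space of
  configurations»* — for the NEAR-`G` part of an orbit this is (R2) (`nearOrbitConstOn_of_analyticOn`); for WHOLE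
  `Gᶜ`-orbits it is the shape `OrbitConstOn`, and the kernel isolates EXACTLY what print's *«This means»* uses
  silently: `orbitConstOn_of_nearOrbitConstOn` — near-orbit constancy + `TubeChainConnected` (any two points of the
  space on one orbit are joined by a chain of tube-valued steps INSIDE the space: a discrete connectedness of
  orbit ∩ {conditions I.(i)–(iv)}) ⇒ (R3); the connectedness is a located INPUT (nothing asserted; whether Bałaban's
  spaces have it is not examined here — recorded in GAPS C-B13-44 as the residual reading of the sentence).
* (R4) *«We extend them to constant functions on whole orbits having non-empty intersections with the space»* —
  KERNEL glue: `OrbitConstOn` is, by the sibling `B12Inv329.orbitExtension_iff` (b12 lineage, [II] p. 22), EXACTLY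
  the well-definedness of that extension (`orbitConstOn_iff_extends`).

THE MODEL.  `𝔸` a unital C⋆-algebra (the ambient matrix algebra `M_N(ℂ) ⊇ Gᶜ ⊇ G`; `G`-valued := unitary-valued, as
in the whole b10/b13 lineage; `Gᶜ`-valued near `G` := tube-valued, in particular pointwise invertible); `ι` = bonds,
`S` = sites, `γ : Ends ι S` = the endpoint maps; configurations `V : ι → 𝔸`; gauge transformations `u : S → 𝔸`
acting by `(Vᵘ)_b = u(b₋)·V_b·u(b₊)⁻¹` (`gaugeAct`, with `Ring.inverse`; on unitary-valued `u` this is the familiar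
`u(b₋)·V_b·u(b₊)⋆`, `gaugeAct_eq_star`); the GROUP of pointwise-invertible transformations `S → 𝔸ˣ` acts on the
type synonym `Cfg γ 𝔸 := ι → 𝔸` by the same formula (`MulAction` instance keyed by `γ`), which is the `𝒢`-set fed to
`orbitExtension_iff`.  The `J`-slots of *«(U, J)»* (sources transforming linearly, `J → R(u)J`) are covered by the
ABSTRACT form `gcExt_of_tubeIdentity` (any family `Φ(u)` holomorphic on the tube and constant on unitary-valued `u` is
constant on the tube), of which the `U`-action statements are instances.

HONEST SCOPE.  (i) (H6) is NOT proved here (one-writer: b10 lineage); every (R2)-theorem carries `hId`.  (ii) `hmaps`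
(near-orbit inside the analyticity domain) and `hG` (invariance under ALL unitary-valued `u`) are hypotheses; by
G-adv7-7 the printed support delivers `hG` only for block-constant `u` — untouched.  (iii) (R3) for whole orbits is a
hypothesis shape, reduced by the kernel to near-orbit constancy + the located connectedness input
`TubeChainConnected`; (R4) is an `iff`, no existence is smuggled.  (iv) Finite index types (`[Fintype S]`, `[Fintype ι]`)
throughout — the lattice is finite at every scale.  (v) No bound, no convergence, no statement about conditions
I.(i)–(iv), Theorem I.3, or the continuum; not Clay progress.

RECORDS: cell GAPS C-B13-44 (this module); CENSUS-B13-v2 row «p. 21–22» addendum (v2.3); no DIVERGENCE entry (the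
formula of the action is [13] (3.28) verbatim); no new bib key (Balaban1988RG2Cluster, Balaban1987RG1,
Balaban1985BackgroundPropagators, Balaban1985UV3 — all in references.bib).
-/

open Set NormedSpace Filter
open scoped Topology

namespace Literature.MathematicalPhysics.QuantumFieldTheory.Balaban1983to89.B13Inv214Orbit

open B10Eq29TubeLine (Tube TubeCfg mem_tube mem_tubeCfg mem_tubeCfg_of_unitary one_mem_tube)
open B10Eq26MeasureInv (TubeIdentity)

/-! ## §1. The action `(Vᵘ)_b = u(b₋)·V_b·u(b₊)⁻¹` ([13] (3.28)) over a unital C⋆-algebra -/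

section Action

/-- Endpoint data of the bonds: `src b = b₋`, `tgt b = b₊`. [folklore] (notation of Balaban1985BackgroundPropagators (3.28) p.395: «Uᵘ(x, x′) = u(x)U(x, x′)u⁻¹(x′)») -/
structure Ends (ι S : Type*) where
  /-- initial point `b₋` of the bond `b` -/
  src : ι → S
  /-- final point `b₊` of the bond `b` -/
  tgt : ι → S

variable {ι S : Type*} {𝔸 : Type*} [CStarAlgebra 𝔸] (γ : Ends ι S)

/-- THE GAUGE ACTION of a (possibly non-unitary) transformation `u : S → 𝔸` on a bond configuration:
`(Vᵘ)_b = u(b₋)·V_b·u(b₊)⁻¹`, with `Ring.inverse` (`= 0` off the units; every tube-valued `u` is pointwise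
invertible, `isUnit_of_mem_tube`). [cite: Balaban1985BackgroundPropagators, (3.28) p.395] -/
noncomputable def gaugeAct (u : S → 𝔸) (V : ι → 𝔸) : ι → 𝔸 :=
  fun b => u (γ.src b) * V b * Ring.inverse (u (γ.tgt b))

/-- A unitary is a unit with inverse its adjoint. [folklore] -/
theorem isUnit_of_mem_unitary {U : 𝔸} (hU : U ∈ unitary 𝔸) : IsUnit U :=
  ⟨⟨U, star U, Unitary.mul_star_self_of_mem hU, Unitary.star_mul_self_of_mem hU⟩, rfl⟩

/-- `Ring.inverse U = U⋆` for a unitary `U`. [folklore] -/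
theorem inverse_eq_star_of_mem_unitary {U : 𝔸} (hU : U ∈ unitary 𝔸) : Ring.inverse U = star U :=
  Ring.inverse_unit (⟨U, star U, Unitary.mul_star_self_of_mem hU, Unitary.star_mul_self_of_mem hU⟩ : 𝔸ˣ)

/-- On UNITARY-valued (`G`-valued) transformations the action is the familiar `u(b₋)·V_b·u(b₊)⋆`. [cite: Balaban1985BackgroundPropagators, (3.28) p.395] -/
theorem gaugeAct_eq_star {u : S → 𝔸} (hu : ∀ x, u x ∈ unitary 𝔸) (V : ι → 𝔸) :
    gaugeAct γ u V = fun b => u (γ.src b) * V b * star (u (γ.tgt b)) := by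
  funext b
  simp only [gaugeAct, inverse_eq_star_of_mem_unitary (hu _)]

/-- The trivial transformation acts trivially. [folklore] -/
theorem gaugeAct_one (V : ι → 𝔸) : gaugeAct γ (fun _ => (1 : 𝔸)) V = V := by
  funext b
  simp [gaugeAct]

/-- Every element of the tube `{exp(B)·U : ‖B‖ < a, U unitary}` is invertible. [folklore] -/
theorem isUnit_of_mem_tube {a : ℝ} {V : 𝔸} (hV : V ∈ Tube 𝔸 a) : IsUnit V := by
  letI : NormedAlgebra ℚ 𝔸 := NormedAlgebra.restrictScalars ℚ ℂ 𝔸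
  obtain ⟨B, U, -, hU, rfl⟩ := hV
  exact (NormedSpace.isUnit_exp B).mul (isUnit_of_mem_unitary hU)

/-- Tube-valued («Gᶜ-valued, in a small neighborhood of the G-valued ones») transformations are pointwise invertible. [folklore] -/
theorem isUnit_of_mem_tubeCfg {a : ℝ} {u : S → 𝔸} (hu : u ∈ TubeCfg S 𝔸 a) (x : S) : IsUnit (u x) :=
  isUnit_of_mem_tube (hu x)

variable [Fintype S]

/-- **ANALYTICITY IN THE GAUGE TRANSFORMATION.**  At a pointwise-invertible `u`, the map `u ↦ Vᵘ` is ℂ-differentiable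
(products and `Ring.inverse` at units, Mathlib `differentiableAt_inverse`). [folklore] -/
theorem differentiableAt_gaugeAct (V : ι → 𝔸) {u : S → 𝔸} (hu : ∀ x, IsUnit (u x)) :
    DifferentiableAt ℂ (fun u' : S → 𝔸 => gaugeAct γ u' V) u := by
  refine differentiableAt_pi.mpr fun b => ?_
  have h1 : DifferentiableAt ℂ (fun u' : S → 𝔸 => u' (γ.src b)) u := differentiableAt_apply (γ.src b) u
  have h2 : DifferentiableAt ℂ (fun u' : S → 𝔸 => u' (γ.tgt b)) u := differentiableAt_apply (γ.tgt b) u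
  have h3 : DifferentiableAt ℂ (Ring.inverse ∘ fun u' : S → 𝔸 => u' (γ.tgt b)) u :=
    (differentiableAt_inverse (hu (γ.tgt b))).comp u h2
  show DifferentiableAt ℂ (fun u' : S → 𝔸 => u' (γ.src b) * V b * Ring.inverse (u' (γ.tgt b))) u
  exact (h1.mul_const (V b)).fun_mul h3

/-- Hence `u ↦ Vᵘ` is ℂ-differentiable on the tube of transformations. [folklore] -/
theorem differentiableOn_gaugeAct (V : ι → 𝔸) (a : ℝ) :
    DifferentiableOn ℂ (fun u : S → 𝔸 => gaugeAct γ u V) (TubeCfg S 𝔸 a) :=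
  fun _u hu => (differentiableAt_gaugeAct γ V (isUnit_of_mem_tubeCfg hu)).differentiableWithinAt

end Action

/-! ## §2. (R2): extension of the invariance *«by the analyticity»* to the tube-valued transformations — modulo (H6) -/

section Extension

variable {ι S : Type*} {𝔸 : Type*} [CStarAlgebra 𝔸] (γ : Ends ι S)

/-- **(R2), ABSTRACT FORM.**  A family `Φ(u)` (an expression evaluated at the transformed configuration `(Uᵘ, R(u)J)`)
which is holomorphic on the tube of transformations and CONSTANT on the unitary-valued ones is constant on the tube —
given the identity principle (H6) `TubeIdentity S 𝔸 a` along the unitary slice, read in the gauge-transformation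
variable. [cite: Balaban1988RG2Cluster, p.21 («the invariance can be extended, by the analyticity, to Gᶜ-valued gauge transformations in a small neighborhood of the space of G-valued ones»)] -/
theorem gcExt_of_tubeIdentity {a : ℝ} (hId : TubeIdentity S 𝔸 a) {Φ : (S → 𝔸) → ℂ} {c : ℂ}
    (hΦ : DifferentiableOn ℂ Φ (TubeCfg S 𝔸 a)) (hG : ∀ u : S → 𝔸, (∀ x, u x ∈ unitary 𝔸) → Φ u = c) :
    ∀ u ∈ TubeCfg S 𝔸 a, Φ u = c :=
  hId Φ (fun _ => c) hΦ (differentiableOn_const c) hG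

/-- **(R2) FOR THE ACTION ON CONFIGURATIONS.**  `G`-invariance `F(Vᵘ) = F(V)` for all unitary-valued `u` (R1) +
holomorphy of `u ↦ F(Vᵘ)` on the tube + (H6) ⇒ `F(Vᵘ) = F(V)` for every tube-valued `u`. [cite: Balaban1988RG2Cluster, pp.21–22] -/
theorem gcInvariant_of_gInvariant {a : ℝ} (hId : TubeIdentity S 𝔸 a) {F : (ι → 𝔸) → ℂ} {V : ι → 𝔸}
    (han : DifferentiableOn ℂ (fun u : S → 𝔸 => F (gaugeAct γ u V)) (TubeCfg S 𝔸 a))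
    (hG : ∀ u : S → 𝔸, (∀ x, u x ∈ unitary 𝔸) → F (gaugeAct γ u V) = F V) :
    ∀ u ∈ TubeCfg S 𝔸 a, F (gaugeAct γ u V) = F V :=
  gcExt_of_tubeIdentity hId han hG

variable [Fintype S] [Fintype ι]

/-- **(R2) FROM *«The expressions are analytic functions of (U, J)»*.**  If `F` is holomorphic on a domain `𝒟` of
configurations which CONTAINS THE NEAR-ORBIT `{Vᵘ : u tube-valued}` (binder `hmaps` = [I] p. 276's proviso «so that
the configurations after the transformations belong to proper spaces also» — NOT discharged), then `u ↦ F(Vᵘ)` is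
holomorphic on the tube (chain rule, §1), and (R1) + (H6) give invariance under the tube-valued transformations.
[cite: Balaban1988RG2Cluster, pp.21–22; Balaban1987RG1, (3.29) p.276] -/
theorem gcInvariant_of_analyticOn {a : ℝ} (hId : TubeIdentity S 𝔸 a) {F : (ι → 𝔸) → ℂ} {𝒟 : Set (ι → 𝔸)}
    (hF : DifferentiableOn ℂ F 𝒟) {V : ι → 𝔸} (hmaps : ∀ u ∈ TubeCfg S 𝔸 a, gaugeAct γ u V ∈ 𝒟)
    (hG : ∀ u : S → 𝔸, (∀ x, u x ∈ unitary 𝔸) → F (gaugeAct γ u V) = F V) :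
    ∀ u ∈ TubeCfg S 𝔸 a, F (gaugeAct γ u V) = F V :=
  gcInvariant_of_gInvariant γ hId (hF.comp (differentiableOn_gaugeAct γ V a) hmaps) hG

end Extension

/-! ## §3. (R3)–(R4): constancy on orbit ∩ space and the extension to whole orbits (`B12Inv329.orbitExtension_iff`) -/

section Orbits

variable {ι S : Type*} {𝔸 : Type*} [CStarAlgebra 𝔸]

/-- The space of bond configurations, as a `𝒢`-set for the group `𝒢 = (S → 𝔸ˣ)` of pointwise-invertible
(«Gᶜ-valued») gauge transformations acting through the endpoint data `γ` (a type synonym of `ι → 𝔸`, so that the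
action can be an instance keyed by `γ`). [folklore] -/
@[nolint unusedArguments]
def Cfg (_γ : Ends ι S) (𝔸 : Type*) : Type _ := ι → 𝔸

variable (γ : Ends ι S)

/-- The `Gᶜ` gauge group `S → 𝔸ˣ` acts on configurations by `(g • V)_b = g(b₋)·V_b·g(b₊)⁻¹`. [cite: Balaban1985BackgroundPropagators, (3.28) p.395] -/
instance instMulActionCfg : MulAction (S → 𝔸ˣ) (Cfg γ 𝔸) where
  smul g V := fun b => (g (γ.src b) : 𝔸) * V b * ((g (γ.tgt b))⁻¹ : 𝔸ˣ)
  one_smul V := by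
    funext b
    change ((1 : S → 𝔸ˣ) (γ.src b) : 𝔸) * V b * (((1 : S → 𝔸ˣ) (γ.tgt b))⁻¹ : 𝔸ˣ) = V b
    simp
  mul_smul g h V := by
    funext b
    change ((g * h) (γ.src b) : 𝔸) * V b * ((((g * h) (γ.tgt b))⁻¹ : 𝔸ˣ) : 𝔸) =
      (g (γ.src b) : 𝔸) * ((h (γ.src b) : 𝔸) * V b * ((h (γ.tgt b))⁻¹ : 𝔸ˣ)) * ((g (γ.tgt b))⁻¹ : 𝔸ˣ)
    simp only [Pi.mul_apply, mul_inv_rev, Units.val_mul, mul_assoc]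

/-- The group action IS the action of §1 on the underlying functions (`Ring.inverse` of a unit = its group
inverse). [folklore] -/
theorem smul_eq_gaugeAct (g : S → 𝔸ˣ) (V : Cfg γ 𝔸) :
    g • V = gaugeAct γ (fun x => (g x : 𝔸)) V := by
  funext b
  change (g (γ.src b) : 𝔸) * V b * ((g (γ.tgt b))⁻¹ : 𝔸ˣ) = _
  simp only [gaugeAct, Ring.inverse_unit]

/-- (R3) AS A HYPOTHESIS SHAPE: *«the expressions are constant on intersections of orbits with the corresponding space
of configurations»* — `F` takes equal values at any two points of the space `𝒮` on one `Gᶜ`-orbit.  For the NEAR-`G`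
part of the orbit this is (R2) (`nearOrbitConstOn_of_gInvariant`); for whole orbits it is print's *«This means»*,
carried as a hypothesis (nothing asserted). [cite: Balaban1988RG2Cluster, p.22] -/
def OrbitConstOn (F : (ι → 𝔸) → ℂ) (𝒮 : Set (ι → 𝔸)) : Prop :=
  ∀ (g : S → 𝔸ˣ) (V : Cfg γ 𝔸), V ∈ 𝒮 → g • V ∈ 𝒮 → F (g • V) = F V

/-- The NEAR-`G` part of (R3) which (R2) delivers: on the space, `F(Vᵘ) = F(V)` for the tube-valued `u` keeping `Vᵘ`
in the space — from (R1) on the space, holomorphy of `F` on a domain containing the near-orbits of the points of the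
space, and (H6). [cite: Balaban1988RG2Cluster, pp.21–22] -/
theorem nearOrbitConstOn_of_gInvariant [Fintype S] [Fintype ι] {a : ℝ} (hId : TubeIdentity S 𝔸 a)
    {F : (ι → 𝔸) → ℂ} {𝒟 𝒮 : Set (ι → 𝔸)} (hF : DifferentiableOn ℂ F 𝒟)
    (hmaps : ∀ V ∈ 𝒮, ∀ u ∈ TubeCfg S 𝔸 a, gaugeAct γ u V ∈ 𝒟)
    (hG : ∀ V ∈ 𝒮, ∀ u : S → 𝔸, (∀ x, u x ∈ unitary 𝔸) → F (gaugeAct γ u V) = F V) :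
    ∀ V ∈ 𝒮, ∀ u ∈ TubeCfg S 𝔸 a, gaugeAct γ u V ∈ 𝒮 → F (gaugeAct γ u V) = F V :=
  fun V hV u hu _ => gcInvariant_of_analyticOn γ hId hF (hmaps V hV) (hG V hV) u hu

/-- (R2) AT EVERY POINT OF THE SPACE, for the group: `F(h • V) = F(V)` whenever `V ∈ 𝒮`, `h` is tube-valued and
`h • V ∈ 𝒮` — constancy along the NEAR-`G` part of orbit ∩ space. [cite: Balaban1988RG2Cluster, pp.21–22] -/
def NearOrbitConstOn (a : ℝ) (F : (ι → 𝔸) → ℂ) (𝒮 : Set (ι → 𝔸)) : Prop :=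
  ∀ (h : S → 𝔸ˣ) (V : Cfg γ 𝔸), (fun x => (h x : 𝔸)) ∈ TubeCfg S 𝔸 a → V ∈ 𝒮 → h • V ∈ 𝒮 → F (h • V) = F V

/-- `NearOrbitConstOn` is what §2 delivers from (R1) on the space, holomorphy of `F` on a domain containing the
near-orbits of the points of the space (`hmaps`, not discharged), and (H6). [cite: Balaban1988RG2Cluster, pp.21–22] -/
theorem nearOrbitConstOn_of_analyticOn [Fintype S] [Fintype ι] {a : ℝ} (hId : TubeIdentity S 𝔸 a)
    {F : (ι → 𝔸) → ℂ} {𝒟 𝒮 : Set (ι → 𝔸)} (hF : DifferentiableOn ℂ F 𝒟)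
    (hmaps : ∀ V ∈ 𝒮, ∀ u ∈ TubeCfg S 𝔸 a, gaugeAct γ u V ∈ 𝒟)
    (hG : ∀ V ∈ 𝒮, ∀ u : S → 𝔸, (∀ x, u x ∈ unitary 𝔸) → F (gaugeAct γ u V) = F V) :
    NearOrbitConstOn γ a F 𝒮 := by
  intro h V hh hV _
  rw [smul_eq_gaugeAct]
  exact gcInvariant_of_analyticOn γ hId hF (hmaps V hV) (hG V hV) _ hh

/-- REACHABILITY INSIDE THE SPACE BY TUBE-VALUED STEPS: `W` is reached from `V` by a finite chain
`V, h₁•V, h₂h₁•V, …, W` of configurations ALL IN `𝒮`, each step a tube-valued (near-`G`) transformation. [folklore] -/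
inductive TubeReach (a : ℝ) (𝒮 : Set (ι → 𝔸)) : Cfg γ 𝔸 → Cfg γ 𝔸 → Prop
  /-- the empty chain at a point of the space -/
  | refl (V : Cfg γ 𝔸) : V ∈ 𝒮 → TubeReach a 𝒮 V V
  /-- one more tube-valued step, landing in the space -/
  | step (V W : Cfg γ 𝔸) (h : S → 𝔸ˣ) : TubeReach a 𝒮 V W → (fun x => (h x : 𝔸)) ∈ TubeCfg S 𝔸 a →
      h • W ∈ 𝒮 → TubeReach a 𝒮 V (h • W)

variable {γ} in
/-- A reachable configuration lies in the space. [folklore] -/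
theorem TubeReach.mem {a : ℝ} {𝒮 : Set (ι → 𝔸)} {V W : Cfg γ 𝔸} (hVW : TubeReach γ a 𝒮 V W) : W ∈ 𝒮 := by
  cases hVW with
  | refl hV => exact hV
  | step _ _ _ _ hW => exact hW

variable {γ} in
/-- Near-orbit constancy propagates along tube chains inside the space. [folklore] -/
theorem TubeReach.apply_eq {a : ℝ} {F : (ι → 𝔸) → ℂ} {𝒮 : Set (ι → 𝔸)} (hF : NearOrbitConstOn γ a F 𝒮)
    {V W : Cfg γ 𝔸} (hVW : TubeReach γ a 𝒮 V W) : F W = F V := by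
  induction hVW with
  | refl _ => rfl
  | step W h hW hh hmem ih => exact (hF h W hh hW.mem hmem).trans ih

/-- THE PRECISE CONTENT OF PRINT'S *«This means»* (located hypothesis shape, nothing asserted): any two points of the
space on one `Gᶜ`-orbit are joined by a tube chain INSIDE the space — a discrete connectedness of orbit ∩ space
(conditions I.(i)–(iv)), which the printed text uses silently when passing from the near-`G` invariance to constancy
on the whole intersection. [cite: Balaban1988RG2Cluster, p.22 («This means that the expressions are constant on intersections of orbits with the corresponding space of configurations»)] -/
def TubeChainConnected (a : ℝ) (𝒮 : Set (ι → 𝔸)) : Prop :=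
  ∀ (g : S → 𝔸ˣ) (V : Cfg γ 𝔸), V ∈ 𝒮 → g • V ∈ 𝒮 → TubeReach γ a 𝒮 V (g • V)

/-- **(R3) FROM (R2)**: near-orbit constancy on the space + tube-chain-connectedness of orbit ∩ space ⇒ the
expressions are constant on intersections of orbits with the space. [cite: Balaban1988RG2Cluster, p.22] -/
theorem orbitConstOn_of_nearOrbitConstOn {a : ℝ} {F : (ι → 𝔸) → ℂ} {𝒮 : Set (ι → 𝔸)}
    (hF : NearOrbitConstOn γ a F 𝒮) (hconn : TubeChainConnected γ a 𝒮) : OrbitConstOn γ F 𝒮 :=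
  fun g V hV hgV => (hconn g V hV hgV).apply_eq hF

/-- **THE WHOLE PARAGRAPH, END TO END** (modulo its located inputs): (R1) on the space `hG` + *«analytic functions»*
`hF` with the near-orbits inside the analyticity domain `hmaps` + (H6) `hId` + the connectedness `hconn` behind
*«This means»* ⇒ (R3) constancy on orbit ∩ space. [cite: Balaban1988RG2Cluster, pp.21–22] -/
theorem orbitConstOn_of_gInvariant [Fintype S] [Fintype ι] {a : ℝ} (hId : TubeIdentity S 𝔸 a)
    {F : (ι → 𝔸) → ℂ} {𝒟 𝒮 : Set (ι → 𝔸)} (hF : DifferentiableOn ℂ F 𝒟)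
    (hmaps : ∀ V ∈ 𝒮, ∀ u ∈ TubeCfg S 𝔸 a, gaugeAct γ u V ∈ 𝒟)
    (hG : ∀ V ∈ 𝒮, ∀ u : S → 𝔸, (∀ x, u x ∈ unitary 𝔸) → F (gaugeAct γ u V) = F V)
    (hconn : TubeChainConnected γ a 𝒮) : OrbitConstOn γ F 𝒮 :=
  orbitConstOn_of_nearOrbitConstOn γ (nearOrbitConstOn_of_analyticOn γ hId hF hmaps hG) hconn

/-- **(R4) = [II] p. 22 «We extend them to constant functions on whole orbits having non-empty intersections with the
space»**: (R3) is EXACTLY the well-definedness of that extension — the sibling `B12Inv329.orbitExtension_iff` for the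
`Gᶜ` gauge group acting on configurations. [cite: Balaban1988RG2Cluster, p.22] -/
theorem orbitConstOn_iff_extends (F : (ι → 𝔸) → ℂ) (𝒮 : Set (ι → 𝔸)) :
    OrbitConstOn γ F 𝒮 ↔
      ∃ Fext : Cfg γ 𝔸 → ℂ, (∀ (g : S → 𝔸ˣ) (V : Cfg γ 𝔸), Fext (g • V) = Fext V) ∧ ∀ V ∈ 𝒮, Fext V = F V :=
  (B12Inv329.orbitExtension_iff (𝒢 := S → 𝔸ˣ) (X := Cfg γ 𝔸) 𝒮 F).symm

/-- In particular, under (R3) the extended function is orbit-constant and agrees with the expression on the space;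
on a `Gᶜ`-invariant space, (R3) is just `Gᶜ`-invariance (`B12Inv329.invariant_of_orbitExtension`). [cite: Balaban1988RG2Cluster, p.22] -/
theorem exists_orbitExtension (F : (ι → 𝔸) → ℂ) (𝒮 : Set (ι → 𝔸)) (h : OrbitConstOn γ F 𝒮) :
    ∃ Fext : Cfg γ 𝔸 → ℂ, (∀ (g : S → 𝔸ˣ) (V : Cfg γ 𝔸), Fext (g • V) = Fext V) ∧ ∀ V ∈ 𝒮, Fext V = F V :=
  (orbitConstOn_iff_extends γ F 𝒮).mp h

end Orbits

/-! ## §4. Non-vacuity -/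

section Toys

/-- One bond from site `true` to site `false`. [folklore] -/
def toyEnds : Ends Unit Bool := ⟨fun _ => true, fun _ => false⟩

/-- The toy action on `𝔸 = ℂ`: `Vᵘ = u(tt)·V·u(ff)⁻¹` — NOT trivial although `ℂ` is commutative (the two endpoints
carry different factors). [folklore] -/
theorem toy_gaugeAct (u : Bool → ℂ) (V : Unit → ℂ) :
    gaugeAct toyEnds u V = fun _ => u true * V () * (u false)⁻¹ := by
  funext b
  simp [gaugeAct, toyEnds, Ring.inverse_eq_inv']

/-- The tube is STRICTLY larger than the unitary slice: for `a > 0`, the constant transformation `exp(a/2)` (real,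
`> 1`) is tube-valued and not unitary-valued — so the conclusions of §2 are not instances of their hypothesis (R1). [folklore] -/
theorem toy_tube_not_unitary {a : ℝ} (ha : 0 < a) :
    (fun _ : Bool => (Real.exp (a / 2) : ℂ)) ∈ TubeCfg Bool ℂ a ∧ (Real.exp (a / 2) : ℂ) ∉ unitary ℂ := by
  constructor
  · intro x
    refine ⟨((a / 2 : ℝ) : ℂ), 1, ?_, one_mem _, ?_⟩
    · rw [Complex.norm_real, Real.norm_eq_abs, abs_of_pos (by positivity)]
      linarith
    · show ((Real.exp (a / 2) : ℝ) : ℂ) = exp ((a / 2 : ℝ) : ℂ) * 1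
      rw [mul_one, Complex.ofReal_exp, Complex.exp_eq_exp_ℂ]
  · intro h
    have h1 : ‖(Real.exp (a / 2) : ℂ)‖ = 1 := CStarRing.norm_of_mem_unitary h
    rw [Complex.norm_real, Real.norm_eq_abs, abs_of_pos (Real.exp_pos _), Real.exp_eq_one_iff] at h1
    linarith

/-- The toy transformation `exp(a/2)` at the site `true`, `1` at the site `false`: tube-valued. [folklore] -/
theorem toy_u_mem_tubeCfg {a : ℝ} (ha : 0 < a) :
    (fun x : Bool => bif x then (Real.exp (a / 2) : ℂ) else 1) ∈ TubeCfg Bool ℂ a := by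
  intro x
  cases x
  · simpa using one_mem_tube (𝔸 := ℂ) ha
  · simpa using (toy_tube_not_unitary ha).1 true

/-- The ANALYTICITY in (R2) is load-bearing: the non-holomorphic expression `F(V) = ‖V‖` is invariant under every
unitary-valued toy transformation but NOT under the tube-valued one of `toy_u_mem_tubeCfg` (at `V = 1`). [folklore] -/
theorem toy_gInvariant_not_gcInvariant {a : ℝ} (ha : 0 < a) :
    (∀ u : Bool → ℂ, (∀ x, u x ∈ unitary ℂ) → ∀ V : Unit → ℂ,
        (‖gaugeAct toyEnds u V ()‖ : ℂ) = (‖V ()‖ : ℂ)) ∧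
      (‖gaugeAct toyEnds (fun x : Bool => bif x then (Real.exp (a / 2) : ℂ) else 1) (fun _ => 1) ()‖ : ℂ) ≠
        (‖(fun _ : Unit => (1 : ℂ)) ()‖ : ℂ) := by
  constructor
  · intro u hu V
    have hn : ∀ x, ‖u x‖ = 1 := fun x => CStarRing.norm_of_mem_unitary (hu x)
    rw [toy_gaugeAct]
    simp [hn]
  · rw [toy_gaugeAct]
    simp only [Bool.cond_true, Bool.cond_false, mul_one, inv_one, norm_one, Complex.ofReal_one, ne_eq,
      Complex.norm_real, Real.norm_eq_abs, abs_of_pos (Real.exp_pos _), Complex.ofReal_eq_one, Real.exp_eq_one_iff]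
    intro h
    linarith

end Toys

end Literature.MathematicalPhysics.QuantumFieldTheory.Balaban1983to89.B13Inv214Orbit
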